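import Literature.AlgebraicGeometry.Motives.FrobIntegralPartVanishingLowDegrees
import Literature.AlgebraicGeometry.Motives.FrobIntegralPartUpperDegrees
import Literature.AlgebraicGeometry.Motives.TateConjectureExtremeCodimensions
import HarnessLib

/-!
# The generalized Tate conjecture has content only in the band `i − d < r ≤ i/2`; the extreme
# degrees `H⁰`, `H^{2d}` (Milne–Ramachandran 2006, §1 Conj. 1.3 / Rem. 1.4 under the Riemann
# hypothesis and Poincaré duality)

Topic `Literature/AlgebraicGeometry/Motives`; THEOREMS ONLY (no definition, no instance, no named
fact; D-0026).

J. S. Milne, N. Ramachandran, arXiv:math/0607483 [MilneRamachandran2006] §1 (held text, chunk p0003):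
Conj. 1.3 (L71–L75) «For a smooth complete variety `X` over `k`, every semisimple Tate substructure
`V ⊂ Hⁱ_l(X)` such that `V(r)` is still effective is contained in `F^r_a Hⁱ_l(X)`»; Rem. 1.4 (L77–L88)
«the generalized Tate conjecture (1.3) is the statement: `F^r_b Hⁱ_l(X) ⊂ F^r_a Hⁱ_l(X)`»; §1.1
(L31–L45): `Hⁱ_l(X)` «is an effective Tate structure of weight `i/2`».  The tree states the conjecture
as the predicate `E.GeneralizedTateStatementFor X := ∀ i r, F^r_b Hⁱ(X) ⊆ F^r_a Hⁱ(X)`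
(`Motives/GeneralizedTateConjecture`) for the abstract `E : GaloisWeilCohomology k K χ` over a finite
field `k` with `q` elements.

For `X` smooth projective of dimension `d` satisfying the tree's Riemann hypothesis
`E.WeilRiemannHypothesisFor X d`, with the cyclotomic normalisation `χ(φ) = q`, the effective-twist
filtration `r ↦ F^r_b Hⁱ(X)` of `Hⁱ(X)` is now known OUTSIDE the band `i − d < r ≤ i/2`:
* `F^r_b Hⁱ(X) = 0` for `2r > i` (weights; row g40-#2, `frobIntegralPart_eq_bot_of_lt`);
* `F^r_b Hⁱ(X) = F⁰_b Hⁱ(X)` (the semisimple part) for `r ≤ i − d` (Poincaré duality, Kahn 2020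
  (3.6.4): the eigenvalues of `Hⁱ`, `i ≥ d`, are divisible by `q^{i−d}`; row g40-#3,
  `frobIntegralPart_eq_frobIntegralPart_zero_of_le`);
* `Hⁱ(X) = 0` for `i > 2d`.
Since `F^r_a` is decreasing in `r` (`coniveauFiltration_antitone`), this file records the REDUCTION:

  **`GT(X) ⟺ [∀ d ≤ i ≤ 2d: F⁰_b Hⁱ(X) ⊆ F^{i−d}_a Hⁱ(X)] ∧ [∀ i r with 2r ≤ i < r + d: F^r_b Hⁱ(X) ⊆ F^r_a Hⁱ(X)]`**
  (`generalizedTateStatementFor_iff_band`),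

and the EXTREME DEGREES (no Riemann hypothesis needed for the `= ⊤` statements): `F^r_b H^{2d}(X) =
H^{2d}(X)` for `r ≤ d` and `F⁰_b H⁰(X) = H⁰(X)` (`H⁰ = K·1 = K·A⁰`, `H^{2d} = K·Aᵈ` are spanned by algebraic
classes, which lie in `F_b` by Ex. 1.5 — the tree's `algebraicClasses_zero_eq_top_univ`,
`algebraicClasses_top_eq_top`, `algebraicClasses_le_frobIntegralPart`), sharp under the Riemann
hypothesis: `F^r_b H^{2d}(X) = H^{2d}(X) ⟺ r ≤ d`, `F^r_b H⁰(X) = H⁰(X) ⟺ r = 0`.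

* §1 `frobIntegralPart_top_eq_top`, `frobIntegralPart_degree_zero_zero_eq_top`,
  `frobIntegralPart_top_eq_top_iff`, `frobIntegralPart_degree_zero_eq_top_iff`,
  `frobIntegralPart_top_eq_bot_iff`.
* §2 `generalizedTateStatementFor_iff_band`; curves: `GT(C) ⟺ F⁰_b H⁰ ⊆ F⁰_a H⁰ ∧ F⁰_b H¹ ⊆ F⁰_a H¹ ∧
  F⁰_b H² ⊆ F¹_a H²` (`generalizedTateStatementFor_curve_iff`); surfaces: the five `F⁰_b`-instances and
  the single genuinely Tate instance `F¹_b H²(S) ⊆ F¹_a H²(S)` (`generalizedTateStatementFor_surface_iff`).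

What is NOT here: the evaluation of `F⁰_a` (for the intended `E`, `F⁰_a Hⁱ = Hⁱ` as `Hⁱ(∅) = 0`; not
available for the abstract `E`), Plain 1.14.  HC is not touched.

## References

* [MilneRamachandran2006] J. S. Milne, N. Ramachandran, arXiv:math/0607483, §1.1, Conj. 1.3, Rem. 1.4,
  Ex. 1.5.
* [Kahn2020] B. Kahn, *Zeta and L-functions of varieties and motives*, CUP (2020), §3.6 (3.6.4).
* [Deligne1974] P. Deligne, *La conjecture de Weil. I*, Thm. (1.6).
* [Tate1994] J. Tate, *Conjectures on algebraic cycles in ℓ-adic cohomology*, §1.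

## Provenance

Lane `lit-hodgefound` (summit `HodgeConjecture`, Track 2 foundations library, Layer B: motives),
seat `lit-hodgefound-p29` (literature-prover, generation 40, row g40-#4).
-/

noncomputable section

open Polynomial

universe u v

namespace Literature.AlgebraicGeometry.Motives

namespace GaloisWeilCohomology

variable {k : Type u} [Field k] [Finite k] {K : Type v} [Field K] [CharZero K]
  {χ : Field.absoluteGaloisGroup k →* Kˣ} (E : GaloisWeilCohomology k K χ)
variable {d : ℕ} {X : SchemeOver k}

/-! ### §1 The extreme degrees `H^{2d}(X)` and `H⁰(X)` -/

/-- **`F^r_b H^{2d}(X) = H^{2d}(X)` for every `r ≤ d`** (`X` smooth projective of dimension `d`,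
`χ(φ) = q`; no Riemann hypothesis): `H^{2d}(X) = K·Aᵈ(X)` is spanned by algebraic classes, which lie in
`F^d_b H^{2d}(X)` (Ex. 1.5), and `F_b` decreases in `r`.
[cite: MilneRamachandran2006, §1 Rem. 1.4 and Ex. 1.5] [cite: Tate1994, §1] -/
theorem frobIntegralPart_top_eq_top (hχ : ((χ (arithFrob k) : Kˣ) : K) = Nat.card k)
    (hX : IsSmoothProjective d X) {r : ℕ} (hr : r ≤ d) : E.frobIntegralPart X (2 * d) r = ⊤ := by
  refine eq_top_iff.mpr (le_trans ?_ (E.frobIntegralPart_antitone hX (2 * d) hr))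
  rw [← E.algebraicClasses_top_eq_top hX]
  exact E.algebraicClasses_le_frobIntegralPart hχ hX d

/-- **`F⁰_b H⁰(X) = H⁰(X)`** (`X` smooth projective, `χ(φ) = q`; no Riemann hypothesis):
`H⁰(X) = K·1 = K·A⁰(X)` and algebraic classes lie in `F_b` (Ex. 1.5); equivalently `ϖ` is the identity
of `H⁰(X)`, semisimple with eigenvalue `1`. [cite: MilneRamachandran2006, §1 Rem. 1.4 and Ex. 1.5] [cite: Tate1994, §1] -/
theorem frobIntegralPart_degree_zero_zero_eq_top (hχ : ((χ (arithFrob k) : Kˣ) : K) = Nat.card k)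
    (hX : IsSmoothProjective d X) : E.frobIntegralPart X 0 0 = ⊤ := by
  refine eq_top_iff.mpr ?_
  have h := E.algebraicClasses_le_frobIntegralPart hχ hX 0
  rw [E.algebraicClasses_zero_eq_top_univ hX] at h
  exact h

/-- **`F^r_b H^{2d}(X) = H^{2d}(X) ⟺ r ≤ d`** under the Riemann hypothesis (for `r > d` the space
`F^r_b H^{2d}(X)` vanishes by the weights, row g40-#2, while `H^{2d}(X) ≠ 0` is a line).
[cite: MilneRamachandran2006, §1.1, Rem. 1.4 and Ex. 1.5] [cite: Deligne1974, Thm. (1.6)] -/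
theorem frobIntegralPart_top_eq_top_iff (hχ : ((χ (arithFrob k) : Kˣ) : K) = Nat.card k)
    (hX : IsSmoothProjective d X) (hRH : E.WeilRiemannHypothesisFor X d) {r : ℕ} :
    E.frobIntegralPart X (2 * d) r = ⊤ ↔ r ≤ d := by
  refine ⟨fun h ↦ ?_, fun hr ↦ E.frobIntegralPart_top_eq_top hχ hX hr⟩
  by_contra hr
  rw [E.frobIntegralPart_eq_bot_of_lt hX hRH (by omega)] at h
  haveI := E.finite_obj hX (2 * d)
  have h1 : Module.finrank K (E.obj X (2 * d)) = 1 := E.finrank_obj_two_mul hX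
  have h0 : Module.finrank K (⊥ : Submodule K (E.obj X (2 * d))) =
      Module.finrank K (⊤ : Submodule K (E.obj X (2 * d))) := by rw [h]
  rw [finrank_bot, finrank_top, h1] at h0
  exact zero_ne_one h0

/-- **`F^r_b H^{2d}(X) = 0 ⟺ d < r`** under the Riemann hypothesis. [cite: MilneRamachandran2006, §1.1, Rem. 1.4 and Ex. 1.5] [cite: Deligne1974, Thm. (1.6)] -/
theorem frobIntegralPart_top_eq_bot_iff (hχ : ((χ (arithFrob k) : Kˣ) : K) = Nat.card k)
    (hX : IsSmoothProjective d X) (hRH : E.WeilRiemannHypothesisFor X d) {r : ℕ} :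
    E.frobIntegralPart X (2 * d) r = ⊥ ↔ d < r := by
  refine ⟨fun h ↦ ?_, fun hr ↦ E.frobIntegralPart_eq_bot_of_lt hX hRH (by omega)⟩
  by_contra hr
  rw [E.frobIntegralPart_top_eq_top hχ hX (by omega)] at h
  haveI := E.finite_obj hX (2 * d)
  have h1 : Module.finrank K (E.obj X (2 * d)) = 1 := E.finrank_obj_two_mul hX
  have h0 : Module.finrank K (⊤ : Submodule K (E.obj X (2 * d))) =
      Module.finrank K (⊥ : Submodule K (E.obj X (2 * d))) := by rw [h]
  rw [finrank_bot, finrank_top, h1] at h0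
  exact one_ne_zero h0

/-- **`F^r_b H⁰(X) = H⁰(X) ⟺ r = 0`** under the Riemann hypothesis (`ϖ = 1` on the line `H⁰(X)`; for
`r ≥ 1`, `F^r_b H⁰ = 0` by the weights). [cite: MilneRamachandran2006, §1.1, Rem. 1.4 and Ex. 1.5] [cite: Deligne1974, Thm. (1.6)] -/
theorem frobIntegralPart_degree_zero_eq_top_iff (hχ : ((χ (arithFrob k) : Kˣ) : K) = Nat.card k)
    (hX : IsSmoothProjective d X) (hRH : E.WeilRiemannHypothesisFor X d) {r : ℕ} :
    E.frobIntegralPart X 0 r = ⊤ ↔ r = 0 := by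
  refine ⟨fun h ↦ ?_, fun hr ↦ hr ▸ E.frobIntegralPart_degree_zero_zero_eq_top hχ hX⟩
  by_contra hr
  rw [E.frobIntegralPart_eq_bot_of_lt hX hRH (by omega)] at h
  haveI := E.finite_obj hX 0
  have h1 : Module.finrank K (E.obj X 0) = 1 := E.finrank_obj_zero hX
  have h0 : Module.finrank K (⊥ : Submodule K (E.obj X 0)) =
      Module.finrank K (⊤ : Submodule K (E.obj X 0)) := by rw [h]
  rw [finrank_bot, finrank_top, h1] at h0
  exact zero_ne_one h0

/-! ### §2 The band reduction of the generalized Tate statement -/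

/-- **`GT(X)` has content only in the band `i − d < r ≤ i/2`**: under the Riemann hypothesis
(`X` smooth projective of dimension `d` over `𝔽_q`, `χ(φ) = q`),
`GT(X) ⟺ [∀ i, d ≤ i ≤ 2d → F⁰_b Hⁱ(X) ⊆ F^{i−d}_a Hⁱ(X)] ∧ [∀ i r, 2r ≤ i → i < r + d → F^r_b Hⁱ(X) ⊆ F^r_a Hⁱ(X)]`:
outside the band, `F^r_b Hⁱ = 0` (`2r > i`), `F^r_b Hⁱ = F⁰_b Hⁱ ⊆ F^{i−d}_a ⊆ F^r_a` (`r ≤ i − d`,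
`F_a` decreasing), or `Hⁱ = 0` (`i > 2d`).
[cite: MilneRamachandran2006, §1 Conj. 1.3 and Rem. 1.4] [cite: Kahn2020, §3.6 (3.6.4)] [cite: Deligne1974, Thm. (1.6)] -/
theorem generalizedTateStatementFor_iff_band (hχ : ((χ (arithFrob k) : Kˣ) : K) = Nat.card k)
    (hX : IsSmoothProjective d X) (hRH : E.WeilRiemannHypothesisFor X d) :
    E.GeneralizedTateStatementFor X ↔
      (∀ i : ℕ, d ≤ i → i ≤ 2 * d →
          E.frobIntegralPart X i 0 ≤ E.coniveauFiltration X i (i - d)) ∧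
        ∀ i r : ℕ, 2 * r ≤ i → i < r + d →
          E.frobIntegralPart X i r ≤ E.coniveauFiltration X i r := by
  constructor
  · intro h
    refine ⟨fun i hdi _ ↦ ?_, fun i r _ _ ↦ h i r⟩
    rw [← E.frobIntegralPart_sub_eq_frobIntegralPart_zero hχ hX hRH hdi]
    exact h i (i - d)
  · rintro ⟨hlow, hband⟩ i r
    by_cases hi : i ≤ 2 * d
    · by_cases h2r : 2 * r ≤ i
      · by_cases hrd : i < r + d
        · exact hband i r h2r hrd
        · -- `r ≤ i - d`: `F^r_b = F⁰_b ⊆ F^{i-d}_a ⊆ F^r_a`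
          have hdi : d ≤ i := by omega
          rw [E.frobIntegralPart_eq_frobIntegralPart_zero_of_le hχ hX hRH (i := i) (r := r) (by omega)]
          exact (hlow i hdi hi).trans (E.coniveauFiltration_antitone X i (show r ≤ i - d by omega))
      · rw [E.frobIntegralPart_eq_bot_of_lt hX hRH (by omega)]
        exact bot_le
    · haveI := E.subsingleton_obj hX (show 2 * d < i by omega)
      exact fun v _ ↦ by rw [Subsingleton.elim v 0]; exact Submodule.zero_mem _

/-- **Equivalently, with the top instance made explicit**: the `i = 2d` instance of the first family reads
`H^{2d}(X) ⊆ F^d_a H^{2d}(X)` (`F⁰_b H^{2d} = H^{2d}`), i.e. the fundamental class is supported in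
codimension `d`. [cite: MilneRamachandran2006, §1 Conj. 1.3, Rem. 1.4 and Ex. 1.5] -/
theorem GeneralizedTateStatementFor.coniveauFiltration_top_eq_top
    (hχ : ((χ (arithFrob k) : Kˣ) : K) = Nat.card k) (hX : IsSmoothProjective d X)
    (h : E.GeneralizedTateStatementFor X) : E.coniveauFiltration X (2 * d) d = ⊤ :=
  eq_top_iff.mpr ((E.frobIntegralPart_top_eq_top hχ hX le_rfl).ge.trans (h (2 * d) d))

/-- `GT(X)` forces `F⁰_a H⁰(X) = H⁰(X)` (the instance `i = r = 0`: `F⁰_b H⁰ = H⁰`).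
[cite: MilneRamachandran2006, §1 Conj. 1.3, Rem. 1.4 and Ex. 1.5] -/
theorem GeneralizedTateStatementFor.coniveauFiltration_degree_zero_eq_top
    (hχ : ((χ (arithFrob k) : Kˣ) : K) = Nat.card k) (hX : IsSmoothProjective d X)
    (h : E.GeneralizedTateStatementFor X) : E.coniveauFiltration X 0 0 = ⊤ :=
  eq_top_iff.mpr ((E.frobIntegralPart_degree_zero_zero_eq_top hχ hX).ge.trans (h 0 0))

/-- **Curves**: for `C` smooth projective of dimension `1` satisfying the Riemann hypothesis,
`GT(C) ⟺ F⁰_b H⁰ ⊆ F⁰_a H⁰ ∧ F⁰_b H¹ ⊆ F⁰_a H¹ ∧ F⁰_b H² ⊆ F¹_a H²` — the band is empty, only the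
semisimple parts are involved. [cite: MilneRamachandran2006, §1 Conj. 1.3 and Rem. 1.4] [cite: Deligne1974, Thm. (1.6)] -/
theorem generalizedTateStatementFor_curve_iff {C : SchemeOver k}
    (hχ : ((χ (arithFrob k) : Kˣ) : K) = Nat.card k) (hC : IsSmoothProjective 1 C)
    (hRH : E.WeilRiemannHypothesisFor C 1) :
    E.GeneralizedTateStatementFor C ↔
      E.frobIntegralPart C 0 0 ≤ E.coniveauFiltration C 0 0 ∧
        E.frobIntegralPart C 1 0 ≤ E.coniveauFiltration C 1 0 ∧
          E.frobIntegralPart C 2 0 ≤ E.coniveauFiltration C 2 1 := by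
  rw [E.generalizedTateStatementFor_iff_band hχ hC hRH]
  constructor
  · rintro ⟨hlow, hband⟩
    exact ⟨hband 0 0 le_rfl (by omega), by simpa using hlow 1 le_rfl (by omega),
      by simpa using hlow 2 (by omega) le_rfl⟩
  · rintro ⟨h0, h1, h2⟩
    refine ⟨fun i hdi hi ↦ ?_, fun i r h2r hrd ↦ ?_⟩
    · interval_cases i
      · simpa using h1
      · simpa using h2
    · obtain rfl : r = 0 := by omega
      obtain rfl : i = 0 := by omega
      exact h0

/-- **Surfaces**: for `S` smooth projective of dimension `2` satisfying the Riemann hypothesis,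
`GT(S)` is equivalent to the five instances on the semisimple parts `F⁰_b Hⁱ ⊆ F^{max(i−2,0)}_a Hⁱ`
(`i = 0, …, 4`) together with the single Tate instance `F¹_b H²(S) ⊆ F¹_a H²(S)` (the Tate conjecture for
divisors over `𝔽`, Ex. 1.5). [cite: MilneRamachandran2006, §1 Conj. 1.3, Rem. 1.4 and Ex. 1.5] [cite: Deligne1974, Thm. (1.6)] -/
theorem generalizedTateStatementFor_surface_iff {S : SchemeOver k}
    (hχ : ((χ (arithFrob k) : Kˣ) : K) = Nat.card k) (hS : IsSmoothProjective 2 S)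
    (hRH : E.WeilRiemannHypothesisFor S 2) :
    E.GeneralizedTateStatementFor S ↔
      (E.frobIntegralPart S 0 0 ≤ E.coniveauFiltration S 0 0 ∧
        E.frobIntegralPart S 1 0 ≤ E.coniveauFiltration S 1 0 ∧
        E.frobIntegralPart S 2 0 ≤ E.coniveauFiltration S 2 0 ∧
        E.frobIntegralPart S 3 0 ≤ E.coniveauFiltration S 3 1 ∧
        E.frobIntegralPart S 4 0 ≤ E.coniveauFiltration S 4 2) ∧
      E.frobIntegralPart S 2 1 ≤ E.coniveauFiltration S 2 1 := by
  rw [E.generalizedTateStatementFor_iff_band hχ hS hRH]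
  constructor
  · rintro ⟨hlow, hband⟩
    exact ⟨⟨hband 0 0 le_rfl (by omega), hband 1 0 (by omega) (by omega),
      by simpa using hlow 2 le_rfl (by omega), by simpa using hlow 3 (by omega) (by omega),
      by simpa using hlow 4 (by omega) le_rfl⟩, hband 2 1 le_rfl (by omega)⟩
  · rintro ⟨⟨h0, h1, h2, h3, h4⟩, h21⟩
    refine ⟨fun i hdi hi ↦ ?_, fun i r h2r hrd ↦ ?_⟩
    · interval_cases i
      · simpa using h2
      · simpa using h3
      · simpa using h4
    · have hr2 : r < 2 := by omega
      interval_cases r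
      · have hi2 : i < 2 := by omega
        interval_cases i
        · exact h0
        · exact h1
      · obtain rfl : i = 2 := by omega
        exact h21

end GaloisWeilCohomology

end Literature.AlgebraicGeometry.Motives

end
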